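import Summits.AtomisticToContinuum.HydrodynamicLimit.Theorems.OneFlightGossipEngineCollisionActivityTailsAbnormalActivityTaggedCount
import HarnessLib

/-!
# `CollisionActivityTails` (stmt-AtomisticToContinuum-13734), line `plaque-thinning-count-ld`, stub 5, TAGGED half — file 3/6:
the kinetic tag at one scale and the speed cap

Helper file (`--supports stmt-AtomisticToContinuum-13734`) of the crux
`Summit.AtomisticToContinuum.HydrodynamicLimit.Theses.OneFlightGossipEngine.CollisionActivityTails`, line `plaque-thinning-count-ld`,
stub 5 (abnormal activity), TAGGED half `stub_taggedFromLabelEnvelope : LabelEnvelopeFromEnvelope → TaggedFromEnvelope`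
(file `…AbnormalActivityTagged`): under the true local Gibbs law the tagged cold window activity (collisions of particles sitting in an
over-dense or over-heated ball at some scale `≥ K`) is small in mean, from a label-set law envelope of the laws at the times of the
window. Vocabulary: `Tagged`, `tagAct`, `TaggedSmallOn`, `TaggedFromEnvelope`, `imp_le_relSpeed` of `…AbnormalActivity(Hot)` (w-abnormal),
`LabelLawEnvelope`, `LabelEnvelopeOn`, `LabelEnvelopeFromEnvelope` of `…EnvelopePlumbing` (lead), `windowEvent`, `pairTubeSet` of
`…AbnormalActivityStatics`.

This file: §4 the KINETIC tag at one scale — exponential Chebyshev and the product expansion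
`𝟙{Y ≤ Σ_j 𝟙_j|v_j|²} ≤ e^{-λY} e^{λ|v_k|²}e^{λ|v_l|²} Σ_{B ⊆ univ∖{k,l}} Π_{j∈B} 𝟙_j (e^{λ|v_j|²}-1)` (`kinInd_le_sum_prod`), the
key cluster bound per label set and the binomial resummation: `∫ tubePair 𝟙{kin} dμ ≤ e^{-λY} C² (1 + C V_R c')^{N-1} 4ε²h J`
(`lintegral_tubePair_kinetic_le`); §5 the SPEED CAP `∫ tubePair 𝟙{∃ j, U < |v_j|} dμ ≤ (N+1) C² max(1, C c') e^{-λU²} 4ε²h J`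
(`lintegral_tubePair_cap_le`, registered helper sub-goal `stub_taggedSpeedCap`).

References: C. Cercignani, R. Illner, M. Pulvirenti, *The Mathematical Theory of Dilute Gases* (1994), §4.3, App. 4.A (collision
cylinders, collision sums along the hard-sphere flow); I. Gallagher, L. Saint-Raymond, B. Texier, *From Newton to Boltzmann* (2013),
Ch. 4. Elementary measure theory and bookkeeping; recorded here.
-/

noncomputable section

open MeasureTheory Set Filter Topology
open scoped ENNReal

namespace Summit.AtomisticToContinuum.HydrodynamicLimit.Theorems.CollisionActivityTailsAbnormalActivityTagged

open Literature.MathematicalPhysics.KineticTheory Literature.Analysis.FluidPDE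
open Summit.AtomisticToContinuum.HydrodynamicLimit.Theorems.CollisionActivityTailsActivityDomination
  (Flow Cfg window act tdist nearCount collisionPairSum_nonneg window_pos)
open Summit.AtomisticToContinuum.HydrodynamicLimit.Theorems.CollisionActivityTailsAbnormalActivityStatics
open Summit.AtomisticToContinuum.HydrodynamicLimit.Theorems.CollisionActivityTailsCrowdedActivityMeasurable
  (measurable_tdist_config natCast_nearCount)
open Summit.AtomisticToContinuum.HydrodynamicLimit.Theorems.CollisionActivityTailsEndpointTails (ae_mem_good_localGibbsLaw)
-- the tagging vocabulary and the two statements of the tagged half (w-abnormal's reduction file, landed):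
open Summit.AtomisticToContinuum.HydrodynamicLimit.Theorems.CollisionActivityTailsAbnormalActivity
  (rec imp relSpeed scaleRadius ballKinetic Tagged tagAct TaggedSmallOn TaggedFromEnvelope imp_le_relSpeed
    hsDiameter_sq_mul_window eventually_window_lt)
-- σ-finiteness of the phase spaces (named instances, landed):
open Summit.AtomisticToContinuum.HydrodynamicLimit.Theorems.MacroBookkeeping (sigmaFinite_volume_phase sigmaFinite_volume_config)
-- the label-set envelope vocabulary (the lead's plumbing, landed with `stub_labelEnvelopeOn`):
open Summit.AtomisticToContinuum.HydrodynamicLimit.Theorems.CollisionActivityTailsEnvelopePlumbing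
  (gaussTupleWeight LabelLawEnvelope LabelEnvelopeOn LabelEnvelopeFromEnvelope)

/-! ## §4 The kinetic tag at one scale -/

section KineticTag

variable {N : ℕ}

/-- Real form of the ball indicator. -/
theorem nearInd_eq_ofReal_ite (R : ℝ) (c x : T3) :
    nearInd R c x = ENNReal.ofReal (if tdist x c ≤ R then (1 : ℝ) else 0) := by
  unfold nearInd; split_ifs <;> simp

/-- **Exponential Chebyshev and the product expansion of the kinetic tag** (`λ = β/4`): on `{Y ≤ Σ_j 𝟙_j |v_j|²}`,
`1 ≤ e^{-λY} Π_j e^{λ 𝟙_j |v_j|²} ≤ e^{-λY} e^{λ|v_k|²} e^{λ|v_l|²} Π_{j ∉ {k,l}} (1 + 𝟙_j (e^{λ|v_j|²} - 1))`, and the last product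
is the sum over the label sets `B ⊆ univ ∖ {k, l}` of `Π_{j ∈ B} 𝟙_j (e^{λ|v_j|²} - 1)`. -/
theorem kinInd_le_sum_prod {β : ℝ} (hβ : 0 ≤ β) {k l : Fin (N + 1)} (hkl : k ≠ l) (R Y : ℝ) (w : Cfg N) :
    (if Y ≤ ballKinetic w k R then (1 : ℝ≥0∞) else 0) ≤
      ENNReal.ofReal (Real.exp (-(β / 4 * Y))) * (expW β (w k).2 * expW β (w l).2) *
        ∑ B ∈ (Finset.univ \ {k, l}).powerset,
          ∏ j ∈ B, nearInd R (w k).1 (w j).1 * ENNReal.ofReal (Real.exp (β / 4 * ‖(w j).2‖ ^ 2) - 1) := by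
  split_ifs with hY
  · set lam : ℝ := β / 4 with hlam
    have hlam0 : 0 ≤ lam := by positivity
    set s : Fin (N + 1) → ℝ := fun j => if tdist (w j).1 (w k).1 ≤ R then ‖(w j).2‖ ^ 2 else 0 with hs
    set r : Fin (N + 1) → ℝ := fun j =>
      (if tdist (w j).1 (w k).1 ≤ R then (1 : ℝ) else 0) * (Real.exp (lam * ‖(w j).2‖ ^ 2) - 1) with hr
    have hS : Y ≤ ∑ j, s j := hY
    have hs0 : ∀ j, 0 ≤ s j := fun j => by simp only [hs]; split_ifs <;> positivity
    have hsle : ∀ j, s j ≤ ‖(w j).2‖ ^ 2 := fun j => by simp only [hs]; split_ifs <;> simp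
    have hr0 : ∀ j, 0 ≤ r j := fun j => by
      simp only [hr]
      refine mul_nonneg (by split_ifs <;> norm_num) ?_
      linarith [Real.one_le_exp (show 0 ≤ lam * ‖(w j).2‖ ^ 2 by positivity)]
    -- Chebyshev
    have h1 : (1 : ℝ) ≤ Real.exp (-(lam * Y)) * ∏ j, Real.exp (lam * s j) := by
      rw [← Real.exp_sum, ← Real.exp_add, ← Finset.mul_sum]
      exact Real.one_le_exp (by nlinarith [hS, hlam0])
    -- split off the pair and expand the rest
    have hsplit : ∏ j, Real.exp (lam * s j) =
        (∏ j ∈ Finset.univ \ {k, l}, Real.exp (lam * s j)) * (Real.exp (lam * s k) * Real.exp (lam * s l)) := by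
      rw [← Finset.prod_sdiff (Finset.subset_univ {k, l}), Finset.prod_pair hkl]
    have hexp : ∀ j, Real.exp (lam * s j) = 1 + r j := by
      intro j; simp only [hs, hr]; split_ifs <;> simp
    have hprod : ∏ j ∈ Finset.univ \ {k, l}, Real.exp (lam * s j) = ∑ B ∈ (Finset.univ \ {k, l}).powerset, ∏ j ∈ B, r j := by
      rw [← Finset.prod_one_add]
      exact Finset.prod_congr rfl fun j _ => hexp j
    have hreal : (1 : ℝ) ≤ Real.exp (-(lam * Y)) * (Real.exp (lam * ‖(w k).2‖ ^ 2) * Real.exp (lam * ‖(w l).2‖ ^ 2)) *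
        ∑ B ∈ (Finset.univ \ {k, l}).powerset, ∏ j ∈ B, r j := by
      have hsum0 : 0 ≤ ∑ B ∈ (Finset.univ \ {k, l}).powerset, ∏ j ∈ B, r j :=
        Finset.sum_nonneg fun B _ => Finset.prod_nonneg fun j _ => hr0 j
      calc (1 : ℝ) ≤ _ := h1
        _ = Real.exp (-(lam * Y)) * (Real.exp (lam * s k) * Real.exp (lam * s l)) *
              ∑ B ∈ (Finset.univ \ {k, l}).powerset, ∏ j ∈ B, r j := by rw [hsplit, hprod]; ring
        _ ≤ _ := by
            gcongr
            · exact hsle k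
            · exact hsle l
    -- to `ℝ≥0∞`
    have hnn1 : 0 ≤ Real.exp (-(lam * Y)) * (Real.exp (lam * ‖(w k).2‖ ^ 2) * Real.exp (lam * ‖(w l).2‖ ^ 2)) := by positivity
    calc (1 : ℝ≥0∞) = ENNReal.ofReal 1 := ENNReal.ofReal_one.symm
      _ ≤ ENNReal.ofReal (Real.exp (-(lam * Y)) * (Real.exp (lam * ‖(w k).2‖ ^ 2) * Real.exp (lam * ‖(w l).2‖ ^ 2)) *
            ∑ B ∈ (Finset.univ \ {k, l}).powerset, ∏ j ∈ B, r j) := ENNReal.ofReal_le_ofReal hreal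
      _ = _ := by
          rw [ENNReal.ofReal_mul hnn1, ENNReal.ofReal_mul (Real.exp_nonneg _), ENNReal.ofReal_mul (Real.exp_nonneg _),
            ENNReal.ofReal_sum_of_nonneg (fun B _ => Finset.prod_nonneg fun j _ => hr0 j)]
          simp only [expW, hlam]
          congr 1
          refine Finset.sum_congr rfl fun B _ => ?_
          rw [ENNReal.ofReal_prod_of_nonneg fun j _ => hr0 j]
          refine Finset.prod_congr rfl fun j _ => ?_
          rw [hr, ENNReal.ofReal_mul (by split_ifs <;> norm_num), nearInd_eq_ofReal_ite]
  · exact bot_le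

/-- The tilted one-label factor of the kinetic tag: `∫ 𝟙{|x-c| ≤ R} (e^{λ|v|²} - 1) e^{-β|v|²/2} d(x,v) ≤ V_R · (4π/β)^{3/2}`. -/
theorem lintegral_nearInd_tilt_le {β : ℝ} (hβ : 0 < β) (R : ℝ) (c : T3) :
    ∫⁻ q : T3 × V3, nearInd R c q.1 * ENNReal.ofReal (Real.exp (β / 4 * ‖q.2‖ ^ 2) - 1) * gaussWeight β q ≤
      ballVol R * ENNReal.ofReal ((2 * Real.pi / (β / 2)) ^ (3 / 2 : ℝ)) := by
  have hψ : Measurable fun v : V3 => ENNReal.ofReal (Real.exp (β / 4 * ‖v‖ ^ 2) - 1) * gaussV β v :=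
    (by fun_prop : Measurable fun v : V3 => ENNReal.ofReal (Real.exp (β / 4 * ‖v‖ ^ 2) - 1)).mul (measurable_gaussV β)
  calc ∫⁻ q : T3 × V3, nearInd R c q.1 * ENNReal.ofReal (Real.exp (β / 4 * ‖q.2‖ ^ 2) - 1) * gaussWeight β q
      = ∫⁻ q : T3 × V3, nearInd R c q.1 * (ENNReal.ofReal (Real.exp (β / 4 * ‖q.2‖ ^ 2) - 1) * gaussV β q.2) := by
        simp only [gaussWeight_eq, mul_assoc]
    _ ≤ ballVol R * ∫⁻ v, ENNReal.ofReal (Real.exp (β / 4 * ‖v‖ ^ 2) - 1) * gaussV β v := lintegral_nearInd_mul_le R c hψ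
    _ ≤ ballVol R * ∫⁻ v, gaussV (β / 2) v := by
        gcongr with v
        rw [← expW_mul_gaussV]
        gcongr
        exact ENNReal.ofReal_le_ofReal (by linarith)
    _ = _ := by rw [lintegral_gaussV (by positivity : 0 < β / 2)]

/-- **KINETIC TAG AT ONE SCALE under a label-set envelope**: with `V = (4π/3)R³`, `c' = (4π/β)^{3/2}`, `J = fluxJ β`, `λ = β/4`,
`∫ tubePair(w_k,w_l) 𝟙{Y ≤ Σ_j 𝟙{|x_j-x_k| ≤ R}|v_j|²} dμ ≤ e^{-λY} C² (1 + C V c')^{N-1} · 4ε²h J`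
(exponential Chebyshev, product expansion over label sets, the key cluster bound per label set, binomial resummation). -/
theorem lintegral_tubePair_kinetic_le {μ : Measure (Cfg N)} {C β : ℝ} (hC : 0 ≤ C) (hβ : 0 < β) (hμ : LabelLawEnvelope μ C β)
    {k l : Fin (N + 1)} (hkl : k ≠ l) {S : V3 → Set V3} (hSm : MeasurableSet {q : V3 × V3 | q.1 ∈ S q.2}) {ε h : ℝ}
    (hεh : 0 ≤ 4 * ε ^ 2 * h) (hSvol : ∀ u, volume (S u) ≤ ENNReal.ofReal (4 * ε ^ 2 * h * ‖u‖)) (R Y : ℝ) :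
    ∫⁻ w, tubePair S (w k) (w l) * (if Y ≤ ballKinetic w k R then 1 else 0) ∂μ ≤
      ENNReal.ofReal (Real.exp (-(β / 4 * Y))) * (ENNReal.ofReal (C ^ 2) *
        (ENNReal.ofReal C * (ballVol R * ENNReal.ofReal ((2 * Real.pi / (β / 2)) ^ (3 / 2 : ℝ))) + 1) ^ (N - 1) *
          (ENNReal.ofReal (4 * ε ^ 2 * h) * fluxJ β)) := by
  set rest : Finset (Fin (N + 1)) := Finset.univ \ {k, l} with hrest
  set Φb : ℝ≥0∞ := ballVol R * ENNReal.ofReal ((2 * Real.pi / (β / 2)) ^ (3 / 2 : ℝ)) with hΦb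
  set P : ℝ≥0∞ := ENNReal.ofReal (4 * ε ^ 2 * h) * fluxJ β with hP
  set T : T3 × V3 → T3 × V3 → ℝ≥0∞ := fun p p' => tubePair S p p' * (expW β p.2 * expW β p'.2) with hT
  set φ : T3 × V3 → T3 × V3 → ℝ≥0∞ := fun p q => nearInd R p.1 q.1 * ENNReal.ofReal (Real.exp (β / 4 * ‖q.2‖ ^ 2) - 1)
    with hφ
  have hTm : Measurable fun pp : (T3 × V3) × (T3 × V3) => T pp.1 pp.2 :=
    (measurable_tubePair hSm).mul (((measurable_expW β).comp measurable_fst.snd).mul ((measurable_expW β).comp measurable_snd.snd))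
  have hφm : Measurable fun pp : (T3 × V3) × (T3 × V3) => φ pp.1 pp.2 := by
    have h1 : Measurable fun pp : (T3 × V3) × (T3 × V3) => nearInd R pp.1.1 pp.2.1 :=
      (measurable_nearInd R).comp (f := fun pp : (T3 × V3) × (T3 × V3) => (pp.1.1, pp.2.1))
        (measurable_fst.fst.prodMk measurable_snd.fst)
    have h2 : Measurable fun pp : (T3 × V3) × (T3 × V3) => ENNReal.ofReal (Real.exp (β / 4 * ‖pp.2.2‖ ^ 2) - 1) := by
      fun_prop
    exact h1.mul h2
  have hTw : Measurable fun w : Cfg N => T (w k) (w l) :=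
    hTm.comp (f := fun w : Cfg N => (w k, w l)) ((measurable_pi_apply k).prodMk (measurable_pi_apply l))
  have hφw : ∀ j, Measurable fun w : Cfg N => φ (w k) (w j) := fun j =>
    hφm.comp (f := fun w : Cfg N => (w k, w j)) ((measurable_pi_apply k).prodMk (measurable_pi_apply j))
  -- each label set
  have hterm : ∀ B ∈ rest.powerset, ∫⁻ w, T (w k) (w l) * ∏ j ∈ B, φ (w k) (w j) ∂μ ≤
      ENNReal.ofReal (C ^ 2) * (ENNReal.ofReal C * Φb) ^ B.card * P := by
    intro B hB
    rw [Finset.mem_powerset] at hB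
    have hBk : k ∉ B := fun h => by simpa [hrest] using hB h
    have hBl : l ∉ B := fun h => by simpa [hrest] using hB h
    have hkey := lintegral_pair_mul_prod_le hC hμ hkl hBk hBl hTm hφm (Φb := Φb) fun p => lintegral_nearInd_tilt_le hβ R p.1
    refine hkey.trans ?_
    gcongr
    exact lintegral_tubePair_expW_le hSm hεh hSvol β
  calc ∫⁻ w, tubePair S (w k) (w l) * (if Y ≤ ballKinetic w k R then 1 else 0) ∂μ
      ≤ ∫⁻ w, ENNReal.ofReal (Real.exp (-(β / 4 * Y))) * ∑ B ∈ rest.powerset, T (w k) (w l) * ∏ j ∈ B, φ (w k) (w j) ∂μ := by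
        refine lintegral_mono fun w => ?_
        refine (mul_le_mul' le_rfl (kinInd_le_sum_prod hβ.le hkl R Y w)).trans (le_of_eq ?_)
        rw [Finset.mul_sum, Finset.mul_sum, Finset.mul_sum]
        refine Finset.sum_congr rfl fun B _ => ?_
        simp only [hT, hφ]
        ring
    _ = ENNReal.ofReal (Real.exp (-(β / 4 * Y))) * ∑ B ∈ rest.powerset, ∫⁻ w, T (w k) (w l) * ∏ j ∈ B, φ (w k) (w j) ∂μ := by
        have hBm : ∀ B : Finset (Fin (N + 1)), Measurable fun w : Cfg N => T (w k) (w l) * ∏ j ∈ B, φ (w k) (w j) :=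
          fun B => hTw.mul (Finset.measurable_prod _ fun j _ => hφw j)
        have hsm : Measurable fun w : Cfg N => ∑ B ∈ rest.powerset, T (w k) (w l) * ∏ j ∈ B, φ (w k) (w j) :=
          Finset.measurable_sum _ fun B _ => hBm B
        rw [lintegral_const_mul _ hsm, lintegral_finsetSum _ fun B _ => hBm B]
    _ ≤ ENNReal.ofReal (Real.exp (-(β / 4 * Y))) *
          ∑ B ∈ rest.powerset, ENNReal.ofReal (C ^ 2) * (ENNReal.ofReal C * Φb) ^ B.card * P := by
        gcongr with B hB
        exact hterm B hB
    _ = _ := by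
        congr 1
        have hbin : ∑ B ∈ rest.powerset, (ENNReal.ofReal C * Φb) ^ B.card * (1 : ℝ≥0∞) ^ (rest.card - B.card) =
            (ENNReal.ofReal C * Φb + 1) ^ rest.card := Finset.sum_pow_mul_eq_add_pow _ _ _
        simp only [one_pow, mul_one] at hbin
        rw [← Finset.sum_mul, ← Finset.mul_sum, hbin, hrest, card_univ_sdiff_pair hkl]

end KineticTag

/-! ## §5 The speed cap -/

section SpeedCap

variable {N : ℕ}

/-- Exponential Chebyshev for one speed: `𝟙{U < |v|} ≤ e^{-λU²} e^{λ|v|²}` (`U ≥ 0`, `λ = β/4 ≥ 0`). -/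
theorem capInd_le {β U : ℝ} (hβ : 0 ≤ β) (hU : 0 ≤ U) (v : V3) :
    (if U < ‖v‖ then (1 : ℝ≥0∞) else 0) ≤ ENNReal.ofReal (Real.exp (-(β / 4 * U ^ 2))) * expW β v := by
  split_ifs with h
  · rw [expW, ← ENNReal.ofReal_mul (Real.exp_nonneg _), ← Real.exp_add, ← ENNReal.ofReal_one]
    refine ENNReal.ofReal_le_ofReal (Real.one_le_exp ?_)
    have : U ^ 2 ≤ ‖v‖ ^ 2 := pow_le_pow_left₀ hU h.le 2
    nlinarith
  · exact bot_le

/-- The capped one-label factor: `∫ 𝟙{U < |v|} e^{-β|v|²/2} d(x, v) ≤ e^{-λU²} (4π/β)^{3/2}` (Haar mass `1`). -/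
theorem lintegral_capInd_le {β U : ℝ} (hβ : 0 < β) (hU : 0 ≤ U) :
    ∫⁻ q : T3 × V3, (if U < ‖q.2‖ then (1 : ℝ≥0∞) else 0) * gaussWeight β q ≤
      ENNReal.ofReal (Real.exp (-(β / 4 * U ^ 2))) * ENNReal.ofReal ((2 * Real.pi / (β / 2)) ^ (3 / 2 : ℝ)) := by
  have hm : Measurable fun v : V3 => (if U < ‖v‖ then (1 : ℝ≥0∞) else 0) * gaussV β v :=
    (Measurable.ite (measurableSet_lt measurable_const measurable_norm) measurable_const measurable_const).mul
      (measurable_gaussV β)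
  calc ∫⁻ q : T3 × V3, (if U < ‖q.2‖ then (1 : ℝ≥0∞) else 0) * gaussWeight β q
      = ∫⁻ v : V3, (if U < ‖v‖ then (1 : ℝ≥0∞) else 0) * gaussV β v := by
        have hm2 : Measurable fun q : T3 × V3 => (if U < ‖q.2‖ then (1 : ℝ≥0∞) else 0) * gaussV β q.2 :=
          hm.comp measurable_snd
        simp only [gaussWeight_eq]
        rw [show (volume : Measure (T3 × V3)) = (volume : Measure T3).prod volume from rfl,
          lintegral_prod _ hm2.aemeasurable]
        trans ∫⁻ _x : T3, ∫⁻ v : V3, (if U < ‖v‖ then (1 : ℝ≥0∞) else 0) * gaussV β v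
        · exact lintegral_congr fun x => rfl
        · rw [lintegral_const, measure_univ, mul_one]
    _ ≤ ∫⁻ v : V3, ENNReal.ofReal (Real.exp (-(β / 4 * U ^ 2))) * gaussV (β / 2) v := by
        refine lintegral_mono fun v => ?_
        rw [← expW_mul_gaussV, ← mul_assoc]
        exact mul_le_mul' (capInd_le hβ.le hU v) le_rfl
    _ = _ := by rw [lintegral_const_mul _ (measurable_gaussV _), lintegral_gaussV (by positivity : 0 < β / 2)]

/-- **THE SPEED CAP under a label-set envelope**: with `c' = (4π/β)^{3/2}`, `J = fluxJ β`, `λ = β/4`, `U ≥ 0`,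
`∫ tubePair(w_k,w_l) 𝟙{∃ j, U < |v_j|} dμ ≤ (N+1) · C² max(1, C c') e^{-λU²} · 4ε²h J` (union over the fast label `j`; for `j ∈ {k,l}`
the tilt `e^{λ|v_j|²}` is absorbed in `J`, for `j ∉ {k, l}` it is one extra label). -/
theorem lintegral_tubePair_cap_le {μ : Measure (Cfg N)} {C β : ℝ} (hC : 0 ≤ C) (hβ : 0 < β) (hμ : LabelLawEnvelope μ C β)
    {k l : Fin (N + 1)} (hkl : k ≠ l) {S : V3 → Set V3} (hSm : MeasurableSet {q : V3 × V3 | q.1 ∈ S q.2}) {ε h : ℝ}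
    (hεh : 0 ≤ 4 * ε ^ 2 * h) (hSvol : ∀ u, volume (S u) ≤ ENNReal.ofReal (4 * ε ^ 2 * h * ‖u‖)) {U : ℝ} (hU : 0 ≤ U) :
    ∫⁻ w, tubePair S (w k) (w l) * (if ∃ j, U < ‖(w j).2‖ then 1 else 0) ∂μ ≤
      ((N : ℝ≥0∞) + 1) * (ENNReal.ofReal (C ^ 2) * max 1 (ENNReal.ofReal C * ENNReal.ofReal ((2 * Real.pi / (β / 2)) ^ (3 / 2 : ℝ))) *
        ENNReal.ofReal (Real.exp (-(β / 4 * U ^ 2))) * (ENNReal.ofReal (4 * ε ^ 2 * h) * fluxJ β)) := by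
  classical
  set c' : ℝ≥0∞ := ENNReal.ofReal ((2 * Real.pi / (β / 2)) ^ (3 / 2 : ℝ)) with hc'
  set eU : ℝ≥0∞ := ENNReal.ofReal (Real.exp (-(β / 4 * U ^ 2))) with heU
  set P : ℝ≥0∞ := ENNReal.ofReal (4 * ε ^ 2 * h) * fluxJ β with hP
  set bound : ℝ≥0∞ := ENNReal.ofReal (C ^ 2) * max 1 (ENNReal.ofReal C * c') * eU * P with hbound
  have htw := measurable_tubePair_cfg hSm k l (N := N)
  have hind : ∀ w : Cfg N, (if ∃ j, U < ‖(w j).2‖ then (1 : ℝ≥0∞) else 0) ≤ ∑ j, (if U < ‖(w j).2‖ then (1 : ℝ≥0∞) else 0) := by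
    intro w
    split_ifs with h
    · obtain ⟨j, hj⟩ := h
      calc (1 : ℝ≥0∞) = (if U < ‖(w j).2‖ then (1 : ℝ≥0∞) else 0) := by rw [if_pos hj]
        _ ≤ ∑ j, (if U < ‖(w j).2‖ then (1 : ℝ≥0∞) else 0) :=
            Finset.single_le_sum (f := fun j => (if U < ‖(w j).2‖ then (1 : ℝ≥0∞) else 0)) (fun _ _ => bot_le)
              (Finset.mem_univ j)
    · exact bot_le
  have hjm : ∀ j, Measurable fun w : Cfg N => (if U < ‖(w j).2‖ then (1 : ℝ≥0∞) else 0) := fun j =>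
    Measurable.ite (measurableSet_lt measurable_const (measurable_pi_apply j).snd.norm) measurable_const measurable_const
  -- the tilted pair functional and its pair integral
  set T : T3 × V3 → T3 × V3 → ℝ≥0∞ := fun p p' => tubePair S p p' * (expW β p.2 * expW β p'.2) with hT
  have hTm : Measurable fun pp : (T3 × V3) × (T3 × V3) => T pp.1 pp.2 :=
    (measurable_tubePair hSm).mul (((measurable_expW β).comp measurable_fst.snd).mul ((measurable_expW β).comp measurable_snd.snd))
  have hTw : Measurable fun w : Cfg N => T (w k) (w l) :=
    hTm.comp (f := fun w : Cfg N => (w k, w l)) ((measurable_pi_apply k).prodMk (measurable_pi_apply l))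
  -- per label
  have hterm : ∀ j, ∫⁻ w, tubePair S (w k) (w l) * (if U < ‖(w j).2‖ then 1 else 0) ∂μ ≤ bound := by
    intro j
    by_cases hjk : j = k ∨ j = l
    · -- the fast particle is one of the pair: absorb the tilt in `T`
      have hpt : ∀ w : Cfg N, tubePair S (w k) (w l) * (if U < ‖(w j).2‖ then 1 else 0) ≤ eU * T (w k) (w l) := by
        intro w
        rw [hT]
        calc tubePair S (w k) (w l) * (if U < ‖(w j).2‖ then 1 else 0)
            ≤ tubePair S (w k) (w l) * (eU * expW β (w j).2) := mul_le_mul' le_rfl (capInd_le hβ.le hU _)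
          _ ≤ eU * (tubePair S (w k) (w l) * (expW β (w k).2 * expW β (w l).2)) := by
              rcases hjk with rfl | rfl
              · calc tubePair S (w j) (w l) * (eU * expW β (w j).2)
                    = eU * (tubePair S (w j) (w l) * (expW β (w j).2 * 1)) := by ring
                  _ ≤ _ := by gcongr; exact one_le_expW hβ.le _
              · calc tubePair S (w k) (w j) * (eU * expW β (w j).2)
                    = eU * (tubePair S (w k) (w j) * (1 * expW β (w j).2)) := by ring
                  _ ≤ _ := by gcongr; exact one_le_expW hβ.le _
      have hkey := lintegral_pair_mul_prod_le hC hμ hkl (A := ∅) (Finset.notMem_empty k) (Finset.notMem_empty l) hTm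
        (φ := fun _ _ => (1 : ℝ≥0∞)) measurable_const (Φb := ⊤) (fun _ => le_top)
      simp only [Finset.prod_empty, Finset.card_empty, pow_zero, mul_one] at hkey
      calc ∫⁻ w, tubePair S (w k) (w l) * (if U < ‖(w j).2‖ then 1 else 0) ∂μ
          ≤ ∫⁻ w, eU * T (w k) (w l) ∂μ := lintegral_mono hpt
        _ = eU * ∫⁻ w, T (w k) (w l) ∂μ := lintegral_const_mul _ hTw
        _ ≤ eU * (ENNReal.ofReal (C ^ 2) * P) := by
            refine mul_le_mul' le_rfl (hkey.trans ?_)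
            exact mul_le_mul' le_rfl (lintegral_tubePair_expW_le hSm hεh hSvol β)
        _ ≤ bound := by
            rw [hbound]
            calc eU * (ENNReal.ofReal (C ^ 2) * P) = ENNReal.ofReal (C ^ 2) * 1 * eU * P := by ring
              _ ≤ _ := by gcongr; exact le_max_left _ _
    · -- the fast particle is a third label
      rw [not_or] at hjk
      have hAk : k ∉ ({j} : Finset (Fin (N + 1))) := by simpa using fun h => hjk.1 h.symm
      have hAl : l ∉ ({j} : Finset (Fin (N + 1))) := by simpa using fun h => hjk.2 h.symm
      have hkey := lintegral_pair_mul_prod_le hC hμ hkl hAk hAl (measurable_tubePair hSm)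
        (φ := fun _ q => (if U < ‖q.2‖ then (1 : ℝ≥0∞) else 0))
        (Measurable.ite (measurableSet_lt measurable_const measurable_snd.snd.norm) measurable_const measurable_const)
        (Φb := eU * c') (fun _ => lintegral_capInd_le hβ hU)
      simp only [Finset.card_singleton, pow_one, Finset.prod_singleton] at hkey
      refine hkey.trans ?_
      calc ENNReal.ofReal (C ^ 2) * (ENNReal.ofReal C * (eU * c')) *
            ∫⁻ pp : (T3 × V3) × (T3 × V3), tubePair S pp.1 pp.2 * gaussWeight β pp.1 * gaussWeight β pp.2
          ≤ ENNReal.ofReal (C ^ 2) * (ENNReal.ofReal C * (eU * c')) * P := by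
            gcongr; exact lintegral_tubePair_gauss_le hSm hεh hSvol hβ.le
        _ = ENNReal.ofReal (C ^ 2) * (ENNReal.ofReal C * c') * eU * P := by ring
        _ ≤ bound := by rw [hbound]; gcongr; exact le_max_right _ _
  calc ∫⁻ w, tubePair S (w k) (w l) * (if ∃ j, U < ‖(w j).2‖ then 1 else 0) ∂μ
      ≤ ∫⁻ w, ∑ j, tubePair S (w k) (w l) * (if U < ‖(w j).2‖ then 1 else 0) ∂μ := by
        refine lintegral_mono fun w => ?_
        rw [← Finset.mul_sum]
        exact mul_le_mul' le_rfl (hind w)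
    _ = ∑ j, ∫⁻ w, tubePair S (w k) (w l) * (if U < ‖(w j).2‖ then 1 else 0) ∂μ := by
        have hjm' : ∀ j, Measurable fun w : Cfg N => tubePair S (w k) (w l) * (if U < ‖(w j).2‖ then 1 else 0) :=
          fun j => htw.mul (hjm j)
        exact lintegral_finsetSum _ fun j _ => hjm' j
    _ ≤ ∑ _j : Fin (N + 1), bound := Finset.sum_le_sum fun j _ => hterm j
    _ = _ := by
        rw [Finset.sum_const, Finset.card_univ, Fintype.card_fin, nsmul_eq_mul, hbound]
        push_cast
        ring

/-- **Helper sub-goal `stub_taggedSpeedCap`** (line `plaque-thinning-count-ld`, stub 5, tagged half, file 3): the speed cap under a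
label-set law envelope (`lintegral_tubePair_cap_le`, closed form). -/
theorem stub_taggedSpeedCap : ∀ {N : ℕ} {μ : Measure (Cfg N)} {C β : ℝ}, 0 ≤ C → 0 < β → LabelLawEnvelope μ C β → ∀ {k l : Fin (N + 1)}, k ≠ l → ∀ {S : V3 → Set V3}, MeasurableSet {q : V3 × V3 | q.1 ∈ S q.2} → ∀ {ε h : ℝ}, 0 ≤ 4 * ε ^ 2 * h → (∀ u, volume (S u) ≤ ENNReal.ofReal (4 * ε ^ 2 * h * ‖u‖)) → ∀ {U : ℝ}, 0 ≤ U → ∫⁻ w, tubePair S (w k) (w l) * (if ∃ j, U < ‖(w j).2‖ then 1 else 0) ∂μ ≤ ((N : ℝ≥0∞) + 1) * (ENNReal.ofReal (C ^ 2) * max 1 (ENNReal.ofReal C * ENNReal.ofReal ((2 * Real.pi / (β / 2)) ^ (3 / 2 : ℝ))) * ENNReal.ofReal (Real.exp (-(β / 4 * U ^ 2))) * (ENNReal.ofReal (4 * ε ^ 2 * h) * fluxJ β)) :=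
  fun hC hβ hμ _ _ hkl _ hSm _ _ hεh hSvol _ hU => lintegral_tubePair_cap_le hC hβ hμ hkl hSm hεh hSvol hU

end SpeedCap

end Summit.AtomisticToContinuum.HydrodynamicLimit.Theorems.CollisionActivityTailsAbnormalActivityTagged

end
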